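import Mathlib.Analysis.SpecialFunctions.Pow.Real
import Mathlib.Analysis.SpecialFunctions.Exp
import Mathlib.Analysis.PSeries
import Mathlib.Combinatorics.Enumerative.Partition.Basic
import Mathlib.Topology.Algebra.InfiniteSum.Real
import Literature.MathematicalPhysics.QuantumManyBody.BoseEinsteinCondensation
import Literature.Combinatorics.Enumerative.CycleIndexSum
import Mathlib.Analysis.Normed.Group.Tannery
import HarnessLib

/-!
# Barrier: infinite Feynman cycles need not represent the Penrose–Onsager condensate — the equivalence is proved only for the perfect and mean-field gases

`Literature/Barriers/AtomisticToContinuum` (D-0021 barrier catalogue; conjunct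
`BoseEinsteinCondensation` of the summit `AtomisticToContinuum`, whose criterion is the
Penrose–Onsager one: `λ_max` of the one-particle density matrix `≥ cN`).

**The results as printed.**

* Sütő 2002 [Suto2002]. Setting (§1): `N` bosons in the cube `Λ` of side `L` with periodic
  boundary conditions; writing the canonical partition function as a sum over permutations,
  `P_{Λ,N}(g) = (N! Q_{Λ,N})⁻¹ Tr_{ℋ^N} U(g) e^{-βH_{Λ,N}}` "can be interpreted as the
  probability of the occurrence of the permutation `g`"; `ξ₁` is "the length of the cycle
  containing 1", `P_{Λ,N}(ξ₁ = j) = j⟨n_j⟩_{Λ,N}/N` (4); after the thermodynamic limit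
  `N/L^d → ρ`, `∑_{j≥1} P_ρ(ξ₁ = j) ≤ 1` (5), and "We speak about cycle percolation ... if
  in this relation the strict inequality holds. In I we conjectured that this happens if and only
  if there is BEC." **Theorem.** "In the perfect and mean-field Bose gases Bose-Einstein
  condensation occurs if and only if there is cycle percolation. In the condensate the number of
  macroscopic cycles is (countable) infinite. Moreover, there are no finite cycles in the
  condensate and no macroscopic cycles outside it." For the ideal gas `H_{Λ,N} = -(ħ²/2m)∑Δᵢ`
  (periodic), `Q_{Λ,N} = ∑_{{n_j}: ∑ jn_j = N} ∏_j (n_j!)⁻¹ (j⁻¹ tr e^{-jβT_{Λ,1}})^{n_j}`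
  (7), `P_{Λ,N}(ξ₁ = j) = N⁻¹ (Q_{Λ,N-j}/Q_{Λ,N}) tr e^{-jβT_{Λ,1}}` (10),
  `P_ρ(ξ₁ = j) ≤ 1/(j^{d/2} ρλ_B^d)` (11), `∑_j P_ρ(ξ₁ = j) ≤ g_{d/2}(1)/(ρλ_B^d)`
  (12), "there is BEC in the free Bose gas if and only if the right-hand side of
  (12) is less than 1, which implies cycle percolation" [Suto2002, §2.1]; and
  `P_ρ(ξ₁ = j) = z^j/(j^{d/2}ρλ_B^d)` with `g_{d/2}(z) = ρλ_B^d` for `ρ < ρ_c` (29),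
  `P_ρ(ξ₁ = j) = 1/(j^{d/2}ρλ_B^d)` for `ρ > ρ_c` (30) [Suto2002, §2.2], so that
  `∑_j P_ρ(ξ₁ = j) = min(1, ρ_c/ρ)` with `ρ_c = g_{d/2}(1)/λ_B^d`, `λ_B = ħ√(2πβ/m)` (the
  half "BEC ⇒ percolation" being [Suto1993]).
* Ueltschi 2006 [Ueltschi2006]. "Feynman's order parameter is simpler; it is often used in
  numerical simulations or in order to gain heuristic understanding. On the other hand,
  everybody agrees that Penrose and Onsager order parameter is the correct one. Surprisingly,
  the question of their equivalence is usually eluded, and many physicists implicitely assume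
  equivalence to hold" [§1]. With `σ(x)` the off-diagonal correlation and `ϱ(n)` the density of
  particles in cycles of length `n` (`ϱ(∞) := ρ - ∑_{n≥1} ϱ(n)`, §2.2), he proposes
  `σ(x) = ∑_{n≥1} c_n(x) ϱ(n) + c_∞(x) ϱ(∞)` with conjectured `0 ≤ c_n, c_∞ ≤ 1`,
  `c_∞(x) → c`; "If `c = 1` ... the off-diagonal long-range order parameter is equal to the
  density of cycles of infinite lengths" [§1]. **Theorem 1** (ideal gas, canonical, any `d`):
  `σ_ρ(x) = ∑_{n≥1} e^{-x²/4nβ} ϱ_ρ(n) + ϱ_ρ(∞)`. **Theorem 2** (interacting, `U ≥ 0`, `μ < 0`):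
  `ϱ_μ(∞) = 0` and `lim_{|x|→∞} limsup_L σ_μ(x) = 0`. **Theorem 3** (cluster-expansion regime):
  `lim_{|x|→∞} c_{n,μ}(x) = 0`. **Theorem 4** (App. B, ideal gas, `d ≥ 3`, units `e^{-βk²}`):
  the canonical zero-mode density `ϱ⁽⁰⁾_ρ = lim_V ⟨n₀⟩/V = max(0, ρ - ρ_c)`, via
  `⟨n_k⟩ = ∑_{i≥1} Prob(n_k ≥ i)`, `Prob(n_k ≥ i) = e^{-βik²} Y(N-i)/Y(N)`. Conclusion (§5):
  "These results seem to indicate that the order parameters of Feynman and Penrose-Onsager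
  agree. However, heuristic considerations ... [Uel2] suggest that, if the gas is in a
  crystalline phase, the coefficients satisfy `c_n(x) ≤ e^{-a|x|}` for some `a > 0`, and for all
  `n` (including `n = ∞`). Besides, one expects that `ϱ(∞) > 0` if the temperature is
  sufficiently low. The order parameters are not equivalent in this case. An open problem is to
  establish the equivalence of the order parameters in weakly interacting gases in presence of
  Bose-Einstein condensation."
* Ueltschi 2006 (PRL) [Ueltschi2006PRL]: "We present a formula that relates both order
  parameters. We discuss its validity with the help of rigorous results and heuristic
  arguments. The conclusion is that infinite cycles do not always represent the Bose
  condensate" [Abstract]; heuristically "`ρ₀ = ϱ(∞)` when interactions are weak; `ρ₀ = 0`,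
  `ϱ(∞) > 0` in a crystal at sufficiently low temperature" [§1]; in a crystal (3D) "the typical
  Feynman trajectories ... is infinite if `β` is large enough, and `lim_{β→∞} ϱ(∞) = ρ`. On the
  other hand, the off-diagonal correlation function shows exponential decay in a crystal, and
  `ρ₀ = 0`" [§"Feynman cycles in crystals"].
* Spatial random permutations [BetzUeltschi2008]: "we expect that weakly interacting bosons can
  be exactly described by a model of spatial permutations with two-body interactions. An
  interesting open problem is to establish this fact rigorously" [§1]; "The models of spatial
  random permutations retain some of the features of the quantum Bose gas in the Feynman-Kac
  representation, but not all of them. The interactions between quantum particles translate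
  into many-body interactions for permutations" [§4].

**Why it is catalogued as a barrier.** A proof of "infinite (macroscopic) cycles at low
temperature / in the ground state" for the interacting gas would not by itself give the
conjunct: the step "cycle percolation ⇒ Penrose–Onsager condensation" is a theorem only for the
perfect and mean-field gases (sources above), is an explicitly open problem for weakly
interacting gases, and is argued to fail in a crystalline phase.

**Lean rendering.** Everything typed is the explicit, elementary ideal-gas side on the torus
of side `L` in the units `ħ = 2m = 1` of `Literature.BoseGas` (`λ_B = √(4πβ)`):
`torusHeatTrace L t = tr e^{tΔ} = (∑_{n∈ℤ} e^{-t(2πn/L)²})³`, the canonical partition function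
`canonicalZ` in Sütő's cycle form §2.1 (7) (a finite sum over `Nat.Partition N`),
`cycleLengthProb β L N j = P_{Λ,N}(ξ₁ = j)` by §2.1 (10), `zeroModeOccupation β L N =
⟨n₀⟩_{Λ,N}` by the displays in Ueltschi's proof of Thm. 4 (App. B), `criticalDensity β = ζ(3/2)(4πβ)^{-3/2}`. Two named facts, both for
`d = 3` along the thermodynamic sequence `L_N = (N/ρ)^{1/3}` (`Literature.MathematicalPhysics.QuantumManyBody.BoseGas.sideLength`, so that
`N = ρL³` exactly, as both sources require): `Suto2002_cyclePercolation` — the limits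
`P_ρ(j) = lim_N P_{Λ_{L_N},N}(ξ₁ = j)` exist and `∑_{j≥1} P_ρ(j) = min(1, ρ_c/ρ)` (the content of
(29)/(30) summed, i.e. cycle-percolation probability `(1 - ρ_c/ρ)₊`); and
`Ueltschi2006_zeroModeOccupation` — Thm. 4, `⟨n₀⟩/L³ → max(0, ρ - ρ_c)`. Together they are the
perfect-gas case of Sütő's Theorem (percolation probability `=` condensate fraction
`= (1 - ρ_c/ρ)₊`; the arithmetic is `percolationProb_eq_condensateFraction`). The catalogue
entry `Literature.Barriers.AtomisticToContinuum.FeynmanCyclesVersusCondensation` is their conjunction;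
the obstruction for interacting gases is prose in the sources (block below). API proved here:
`canonicalZ_zero/one`, positivity of `tr e^{tΔ}` and of `Q_{Λ,N}` (`torusHeatTrace_pos`,
`canonicalZ_pos`), `cycleLengthProb_one_one`.

**Barrier audit 2026-08-15 (refuter): narrowed entry `FeynmanCyclesVersusCondensationNarrow`.**
The catalogued obstruction (no printed implication "infinite cycles ⇒ Penrose–Onsager
condensation" for interacting bosons) stands, but three corrections are recorded in the narrowed
entry at the end of this file, with page-level citations, and its formal content is PROVED here
(`feynmanCyclesVersusCondensationNarrow_holds`): (i) the `technique_class:` tokens of the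
catalogued block over-reach — the Feynman–Kac representation expresses the off-diagonal
correlation EXACTLY as an open-cycle ("worm") weight [Ueltschi2006, §2.3 (odlro), App. A], and in
the random-loop representations of quantum lattice models two-point functions ARE
loop-connectivity probabilities [Ueltschi2013, Thm. 3.3], for the hard-core lattice Bose gas
`⟨a_x†a_y⟩ = 2⟨S_x³S_y³⟩` [Ueltschi2013, §7.1] — only CLOSED-cycle statistics are obstructed;
(ii) the missing implication is false in print already for the PERFECT gas outside cubes: in
Casimir prisms `α₁ > 1/2` the long cycles carry `ρ - ρ_c` [Beau2009, Thm. 2.2] under type III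
condensation with no macroscopically occupied level [PuleZagrebnov2004, Prop. 2.2, Cor. 3.2], the
cycles being "long-microscopic" of order `V^δ` [Beau2009, Thm. 4.3] — percolation tracks
generalized condensation, cycles of length `∝ N` track macroscopic occupation; (iii) in the
conjunct's own order of limits (ground state at fixed `N`, `L`; then `N → ∞`) closed-cycle
statistics are saturated: for the perfect gas `Q_{Λ,N} → 1`, `P_{Λ,N}(ξ₁ = j) → 1/N` (uniform
permutation law) and `⟨n₀⟩_{Λ,N} → N` as `β → ∞` (`tendsto_canonicalZ_atTop`,
`tendsto_cycleLengthProb_atTop`, `tendsto_zeroModeOccupation_atTop`; the theta-function limit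
`tr e^{tΔ} → 1` is `tendsto_torusHeatTrace_atTop`, the class equation
`∑_{p ⊢ N} ∏_j j^{-n_j}/n_j! = 1` comes from `Literature.Combinatorics.Enumerative.cycleIndexSum`),
and "there are only infinite cycles at zero temperature … infinite cycles can carry other than the
condensate" [Suto2024, p. 11]. New in refereed print since the entry was written: "the existence
of infinite cycles is necessary but not sufficient for BEC" [Suto2024, Abstract, §2].

## References

* [Suto2002] A. Sütő, *Percolation transition in the Bose gas: II*, J. Phys. A 35 (2002)
  6995–7002, arXiv:cond-mat/0204430: Abstract, §1 ((1), (2), (4), (5), Theorem), §2.1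
  ((6)–(12)), §2.2 ((25), (26), (29), (30)), §2.3 (held; equations numbered consecutively as
  in the arXiv edition, where the text's "equation (34)" fixes the count).
* [Suto1993] A. Sütő, *Percolation transition in the Bose gas*, J. Phys. A 26 (1993) 4689–4710
  (Sütő's "I"; not re-read, cited via Suto2002 §1).
* [Ueltschi2006] D. Ueltschi, *Feynman cycles in the Bose gas*, J. Math. Phys. 47 (2006)
  123303, arXiv:math-ph/0605002: §1, §2.2, §2.3, Thm. 1, Thm. 2, Thm. 3, §5, App. B Thm. 4 and
  its proof (held).
* [Ueltschi2006PRL] D. Ueltschi, *Relation between Feynman cycles and off-diagonal long-range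
  order*, Phys. Rev. Lett. 97 (2006) 170601, arXiv:cond-mat/0604005: Abstract, §1, section
  "Feynman cycles in crystals" (held).
* [BetzUeltschi2008] V. Betz, D. Ueltschi, *Spatial random permutations and infinite cycles*,
  Commun. Math. Phys. 285 (2009) 469–501, arXiv:0711.1188: §1, §4 (held).
* [PenroseOnsager1956] O. Penrose, L. Onsager, Phys. Rev. 104 (1956) 576.
* [claim: Suto2021, status: under-review] A. Sütő, *Simultaneous occurrence of off-diagonal
  long-range order and infinite permutation cycles in systems of interacting atoms*,
  arXiv:2108.02659 (Theorem, Remark 2: for positive-type pair potentials ODLRO iff infinite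
  cycles; unrefereed preprint; no journal version found on Crossref, 2026-08-15).
* [Suto2024] A. Sütő, *Infinite cycles of interacting bosons*, Phys. Scr. 99 (2024) 125252,
  arXiv:2409.19695 (refereed; read: Abstract, §1, §2 pp. 3–4, §3.1, concluding remarks p. 11).
* [Ueltschi2013] D. Ueltschi, *Random loop representations for quantum spin systems*, J. Math.
  Phys. 54 (2013) 083301, arXiv:1301.0811 (read: Thm. 3.3, Thm. 3.4, §7.1).
* [Beau2009] M. Beau, *A scaling approach to the existence of long cycles in Casimir boxes*,
  J. Phys. A 42 (2009) 235204, arXiv:0810.4001 (read: §1, Thm. 2.1, Thm. 2.2, Thm. 4.3).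
* [PuleZagrebnov2004] J. V. Pulé, V. A. Zagrebnov, *The canonical perfect Bose gas in Casimir
  boxes*, J. Math. Phys. 45 (2004) 3565–3583, arXiv:math-ph/0405043 (Prop. 2.2, Cor. 3.2; as
  vendored in `CasimirBoxGeneralizedCondensation.lean`).
* [QuitmannTaggi2023] A. Quitmann, L. Taggi, *Macroscopic loops in the Bose gas, spin O(N) and
  related models*, Commun. Math. Phys. 400 (2023) 2081–2136, arXiv:2201.04047 (read: §1,
  Thm. 1.1, Def. 5.1, §9.1–9.1.1).
* [BolandPule2008] G. Boland, J. V. Pulé, J. Stat. Phys. 132 (2008) 881–905; [Boland2009]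
  G. Boland, J. Math. Phys. 50 (2009) 073301; [DorlasMartinPule2005] T. C. Dorlas, Ph. A. Martin,
  J. V. Pulé, J. Stat. Phys. 121 (2005) 433–461 — not read (paywalled), cited via [Suto2024, §1].
* [KennedyLiebShastry1988] T. Kennedy, E. H. Lieb, B. S. Shastry, Phys. Rev. Lett. 61 (1988)
  2582 — cited via [Ueltschi2013, §7.1].
-/

noncomputable section

open Filter Topology Finset
open scoped BigOperators

namespace Literature.Barriers.AtomisticToContinuum.BoseGas.IdealGas

/-- `tr e^{tΔ}` on the flat torus `(ℝ/Lℤ)³` (one particle, units `ħ = 2m = 1`, spectrum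
`|k|²`, `k ∈ (2π/L)ℤ³`): `z_L(t) = (∑_{n∈ℤ} e^{-t(2πn/L)²})³ = tr exp(-t T_{Λ,1})`.
[cite: Suto2002, §2.1 (6)–(8)] -/
def torusHeatTrace (L t : ℝ) : ℝ :=
  (∑' n : ℤ, Real.exp (-(t * (2 * Real.pi * n / L) ^ 2))) ^ 3

/-- The canonical partition function of `N` free bosons on the torus of side `L` at inverse
temperature `β`, in Sütő's cycle form: `Q_{Λ,N} = ∑_{{n_j} : ∑ j n_j = N} ∏_j (n_j!)⁻¹
(j⁻¹ tr e^{-jβT_{Λ,1}})^{n_j}` (sum over cycle types = partitions of `N`; `Q_{Λ,0} = 1`).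
[cite: Suto2002, §2.1 (7)] -/
def canonicalZ (β L : ℝ) (N : ℕ) : ℝ :=
  ∑ p : Nat.Partition N, ∏ j ∈ p.parts.toFinset,
    (torusHeatTrace L (j * β) / j) ^ p.parts.count j / (p.parts.count j).factorial

/-- The probability that particle `1` lies in a permutation cycle of length `j` in the
canonical ensemble of `N` free bosons on the torus:
`P_{Λ,N}(ξ₁ = j) = N⁻¹ tr e^{-jβT_{Λ,1}} Q_{Λ,N-j}/Q_{Λ,N}` (`1 ≤ j ≤ N`; `0` otherwise).
[cite: Suto2002, §1 (4) and §2.1 (10)] -/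
def cycleLengthProb (β L : ℝ) (N j : ℕ) : ℝ :=
  if 1 ≤ j ∧ j ≤ N then
    torusHeatTrace L (j * β) * canonicalZ β L (N - j) / (N * canonicalZ β L N)
  else 0

/-- The canonical expectation of the zero-momentum occupation number,
`⟨n₀⟩_{Λ,N} = ∑_{i=1}^{N} Prob(n₀ ≥ i) = ∑_{i=1}^{N} Y(N-i)/Y(N)` (`Y = Q_{Λ,·}` the canonical
partition function). [cite: Ueltschi2006, App. B (proof of Thm. 4)] -/
def zeroModeOccupation (β L : ℝ) (N : ℕ) : ℝ :=
  ∑ i ∈ Finset.Icc 1 N, canonicalZ β L (N - i) / canonicalZ β L N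

/-- The thermal wavelength `λ_B = √(4πβ)` (`ħ = 2m = 1`; `e^{-βk²}` with `k = 2πn/L` is
`e^{-πλ_B²n²/L²}`). [cite: Suto2002, §2.1 (8)–(9)] -/
def thermalWavelength (β : ℝ) : ℝ := Real.sqrt (4 * Real.pi * β)

/-- The critical density of the three-dimensional ideal Bose gas,
`ρ_c(β) = g_{3/2}(1)/λ_B³ = ζ(3/2) (4πβ)^{-3/2}`. [cite: Suto2002, §2.2 (Remark 1, before (29))]
[cite: Ueltschi2006, App. B (density formula before Thm. 4)] -/
def criticalDensity (β : ℝ) : ℝ :=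
  (∑' j : ℕ, 1 / ((j + 1 : ℝ) ^ (3 / 2 : ℝ))) / thermalWavelength β ^ 3

/-! ### Named facts -/

/-- **Sütő 2002, perfect Bose gas, `d = 3`: the cycle-length distribution in the
thermodynamic limit.** For `β, ρ > 0`, along `L_N = (N/ρ)^{1/3}`: for every `j ≥ 1` the limit
`P_ρ(ξ₁ = j) = lim_N P_{Λ_{L_N},N}(ξ₁ = j)` exists, and `∑_{j≥1} P_ρ(ξ₁ = j) = min(1, ρ_c(β)/ρ)` —
by (29) `P_ρ(ξ₁=j) = z^j/(j^{3/2}ρλ_B³)`, `g_{3/2}(z) = ρλ_B³`, for `ρ < ρ_c`, and (30)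
`P_ρ(ξ₁=j) = 1/(j^{3/2}ρλ_B³)` for `ρ ≥ ρ_c` (equality in (11), §2.2 Remark 2). Hence the
cycle-percolation probability `1 - ∑_j P_ρ(ξ₁=j)` is `(1 - ρ_c/ρ)₊`, positive iff `ρ > ρ_c` iff
BEC: the perfect-gas case of Sütő's Theorem ("Bose-Einstein condensation occurs if and only if
there is cycle percolation"). [cite: Suto2002, Theorem, §2.1 (10)–(12), §2.2 (29)–(30)] -/
def Suto2002_cyclePercolation : Prop :=
  ∀ β ρ : ℝ, 0 < β → 0 < ρ →
    ∃ P : ℕ → ℝ,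
      (∀ j : ℕ, 1 ≤ j →
        Tendsto (fun N : ℕ => cycleLengthProb β (Literature.MathematicalPhysics.QuantumManyBody.BoseGas.sideLength ρ N) N j) atTop (𝓝 (P j))) ∧
      HasSum (fun j : ℕ => P (j + 1)) (min 1 (criticalDensity β / ρ))

/-- **Ueltschi 2006, Theorem 4 (macroscopic occupation in the ideal gas, canonical ensemble),
`d = 3`.** For `β, ρ > 0`, along `L_N = (N/ρ)^{1/3}` (`N = ρV`): the canonical zero-mode density
`⟨n₀⟩_{Λ,N}/V` converges to `max(0, ρ - ρ_c)`. (Printed for all `d ≥ 3`; typed for `d = 3`.)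
[cite: Ueltschi2006, App. B Thm. 4] -/
def Ueltschi2006_zeroModeOccupation : Prop :=
  ∀ β ρ : ℝ, 0 < β → 0 < ρ →
    Tendsto (fun N : ℕ => zeroModeOccupation β (Literature.MathematicalPhysics.QuantumManyBody.BoseGas.sideLength ρ N) N / Literature.MathematicalPhysics.QuantumManyBody.BoseGas.sideLength ρ N ^ 3) atTop
      (𝓝 (max 0 (ρ - criticalDensity β)))

/-! ### Basic API -/

/-- The Gaussian lattice sum defining `tr e^{tΔ}` converges (`t > 0`, `L ≠ 0`). [folklore] -/
theorem summable_torusHeat {L t : ℝ} (hL : L ≠ 0) (ht : 0 < t) :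
    Summable fun n : ℤ => Real.exp (-(t * (2 * Real.pi * n / L) ^ 2)) := by
  have hc : -(t * (2 * Real.pi / L) ^ 2) < 0 := by
    have : 0 < (2 * Real.pi / L) ^ 2 := by positivity
    nlinarith
  have key : ∀ n : ℤ, Real.exp (-(t * (2 * Real.pi * n / L) ^ 2)) =
      Real.exp (-(t * (2 * Real.pi / L) ^ 2) * ((n.natAbs : ℝ)) ^ 2) := by
    intro n
    congr 1
    rw [Nat.cast_natAbs, Int.cast_abs, sq_abs]
    ring
  simp_rw [key]
  have hN : Summable fun m : ℕ => Real.exp (-(t * (2 * Real.pi / L) ^ 2) * ((m : ℝ)) ^ 2) := by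
    have := Real.summable_exp_nat_mul_of_ge hc (f := fun m : ℕ => ((m : ℝ)) ^ 2) (fun i => ?_)
    · simpa using this
    · have : (1 : ℝ) ≤ i ∨ (i : ℝ) = 0 := by
        rcases Nat.eq_zero_or_pos i with h | h
        · right; exact_mod_cast h
        · left; exact_mod_cast h
      rcases this with h | h
      · nlinarith
      · simp [h]
  exact .of_nat_of_neg (by simpa using hN) (by simpa using hN)

/-- `tr e^{tΔ} > 0` on the torus (`t > 0`, `L ≠ 0`). [folklore] -/
theorem torusHeatTrace_pos {L t : ℝ} (hL : L ≠ 0) (ht : 0 < t) : 0 < torusHeatTrace L t := by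
  unfold torusHeatTrace
  exact pow_pos ((summable_torusHeat hL ht).tsum_pos (fun n => (Real.exp_pos _).le) 0
    (Real.exp_pos _)) 3

/-- The canonical partition function is positive (`β > 0`, `L ≠ 0`): every cycle type
contributes a positive weight. [folklore] -/
theorem canonicalZ_pos {β L : ℝ} (hβ : 0 < β) (hL : L ≠ 0) (N : ℕ) : 0 < canonicalZ β L N := by
  unfold canonicalZ
  refine Finset.sum_pos (fun p _ => Finset.prod_pos fun j hj => ?_) Finset.univ_nonempty
  have hj : 0 < j := p.parts_pos (Multiset.mem_toFinset.mp hj)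
  have hz : 0 < torusHeatTrace L (j * β) := torusHeatTrace_pos hL (by positivity)
  positivity

/-- `Q_{Λ,0} = 1` (the empty product over the unique partition of `0`). [folklore] -/
@[simp] theorem canonicalZ_zero (β L : ℝ) : canonicalZ β L 0 = 1 := by
  simp [canonicalZ]

/-- For one particle the only cycle has length `1`: `P_{Λ,1}(ξ₁ = 1) = 1` whenever
`Q_{Λ,1} ≠ 0`. [folklore] -/
theorem cycleLengthProb_one_one (β L : ℝ) (h : canonicalZ β L 1 ≠ 0) :
    cycleLengthProb β L 1 1 = 1 := by
  have hZ1 : canonicalZ β L 1 = torusHeatTrace L β := by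
    simp [canonicalZ]
  rw [hZ1] at h
  simp only [cycleLengthProb, le_refl, and_self, if_true, Nat.sub_self, canonicalZ_zero, hZ1,
    Nat.cast_one, one_mul, mul_one]
  exact div_self h

/-- `Q_{Λ,1} = tr e^{-βT_{Λ,1}}` (one particle, one cycle). [folklore] -/
theorem canonicalZ_one (β L : ℝ) : canonicalZ β L 1 = torusHeatTrace L β := by
  simp [canonicalZ]

/-- The equivalence as an identity of limits: under the two named facts, the cycle-percolation
probability `1 - ∑_j P_ρ(j)` equals the condensate fraction `lim ⟨n₀⟩/(ρL³)`, both being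
`max(0, 1 - ρ_c/ρ)`. [cite: Suto2002, Theorem] -/
theorem percolationProb_eq_condensateFraction {β ρ : ℝ} (hρ : 0 < ρ) :
    1 - min 1 (criticalDensity β / ρ) = max 0 (ρ - criticalDensity β) / ρ := by
  rcases le_or_gt (criticalDensity β) ρ with h | h
  · rw [min_eq_right ((div_le_one hρ).mpr h), max_eq_right (sub_nonneg.mpr h)]
    field_simp
  · rw [min_eq_left ((one_le_div hρ).mpr h.le), max_eq_left (sub_nonpos.mpr h.le)]
    simp

end Literature.Barriers.AtomisticToContinuum.BoseGas.IdealGas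

namespace Literature.Barriers.AtomisticToContinuum

open BoseGas.IdealGas

/-- **Barrier entry: "infinite cycles ⇒ Penrose–Onsager condensation" is proved only for the
perfect and mean-field gases; for interacting bosons it is open, and argued to fail in
crystals.** FORMAL content: the conjunction of the two ideal-gas facts
`Suto2002_cyclePercolation` (cycle-percolation probability `(1 - ρ_c/ρ)₊`) and
`Ueltschi2006_zeroModeOccupation` (condensate density `(ρ - ρ_c)₊`), i.e. the perfect-gas case
of Sütő's equivalence theorem; the obstruction beyond the ideal gas is the cited prose below.
Technique class in words: Feynman–Kac / spatial-random-permutation order parameters — proving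
condensation by exhibiting infinite or macroscopic permutation cycles, cycle percolation, or
winding of Brownian bridges in the path-integral representation of `Tr e^{-βH_N}` (slug tokens
in the block).
BARRIER (D-0021), AtomisticToContinuum/BoseEinsteinCondensation:
technique_class: feynman-kac path-integral feynman-cycles cycle-percolation infinite-cycles long-cycles macroscopic-cycles random-permutations spatial-random-permutations permutation-cycles loop-gas brownian-bridges winding-numbers random-loop-representation
blocks: the passage from cycle percolation to the Penrose–Onsager criterion of `BoseEinsteinCondensation` (`λ_max(γ) ≥ cN`, off-diagonal long-range order) for interacting bosons: the equivalence is a theorem for "the perfect and mean-field Bose gases" only [cite: Suto2002, Theorem] [cite: Ueltschi2006, Thm. 1 and §1 (refs. [BCMP], [DMP])]; "An open problem is to establish the equivalence of the order parameters in weakly interacting gases in presence of Bose-Einstein condensation" [cite: Ueltschi2006, §5]; "infinite cycles do not always represent the Bose condensate" [cite: Ueltschi2006PRL, Abstract]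
because: off-diagonal order and cycle densities are related by `σ(x) = ∑_n c_n(x)ϱ(n) + c_∞(x)ϱ(∞)` with `c_∞(x) → c ∈ [0,1]` conjectural, so ODLRO `= c·ϱ(∞)` detects infinite cycles only if `c > 0`; `c_∞ ≡ 1` is proved for the ideal gas [cite: Ueltschi2006, §1 and Thm. 1], while in a crystalline phase heuristically `c_n(x) ≤ e^{-a|x|}` for all `n` including `∞` and `ϱ(∞) > 0` at low temperature — `ρ₀ = 0`, `ϱ(∞) > 0`, indeed `lim_{β→∞} ϱ(∞) = ρ` [cite: Ueltschi2006, §5] [cite: Ueltschi2006PRL, §1 and section "Feynman cycles in crystals"]; moreover genuine pair interactions become many-body interactions between permutation jumps, outside the solved random-permutation models [cite: BetzUeltschi2008, §1 and §4]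
evasions_known: none for genuinely interacting continuum bosons in print as a refereed theorem: the ideal gas [cite: Suto2002, Theorem] [cite: Ueltschi2006, Thm. 1 and App. B Thm. 4], mean-field gases [cite: Suto2002, Theorem] [cite: Ueltschi2006, §1], absence of both orders at `μ < 0` / high temperature [cite: Ueltschi2006, Thm. 2 and Thm. 3], and spatial random permutations with jump weights [cite: BetzUeltschi2008, §1]; a claimed proof of "ODLRO iff infinite cycles" for positive-type pair potentials on the torus is an unrefereed preprint [claim: Suto2021, status: under-review]
scope_caveats: (a) the non-equivalence in crystals is a heuristic argument, not a theorem [cite: Ueltschi2006, §5] [cite: Ueltschi2006PRL, Abstract]; no printed result says cycle methods cannot prove ODLRO — the barrier is the missing implication; (b) all typed objects are positive-temperature canonical quantities of the IDEAL gas in `d = 3` (Sütő's Theorem also covers the mean-field gas and the structure of macroscopic cycles, Ueltschi's Thm. 4 all `d ≥ 3`, Thm. 1 all `d ≥ 1` — not typed), whereas the conjunct is a ground-state statement for the interacting gas; (c) both sources take the limit along volumes with `N = ρV` (Ueltschi) or `N/L^d → ρ` (Sütő); the facts are typed along `L_N = (N/ρ)^{1/3}` only, and the existence of `lim P_{Λ,N}(ξ₁=j)`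 is read from (29)/(30) [cite: Suto2002, §2.2]; (d) [cite: Suto1993, via Suto2002 §1] was not re-read; (e) AUDIT 2026-08-15 (refuter barrier-audit): the `technique_class:` tokens and caveat (a) above are superseded by `FeynmanCyclesVersusCondensationNarrow` at the end of this file — only CLOSED-cycle statistics are obstructed (the open-cycle weight IS `σ(x)` [cite: Ueltschi2006, §2.3]; lattice loop representations carry exact correlation = connectivity identities [cite: Ueltschi2013, Thm. 3.3 and §7.1]); the missing implication is false in print for the perfect gas in Casimir prisms (`ρ_long = ρ - ρ_c` [cite: Beau2009, Thm. 2.2] with type III condensation [cite: PuleZagrebnov2004, Cor. 3.2]); in the ground-state order of limits of the conjunct the cycle law is uniform for every `N` (proved there for the perfect gas), so it carries no information about `λ_max(γ_{Ψ₀})`; and "infinite cycles necessary but not sufficient for BEC" is now in refereed print [cite: Suto2024, Abstract]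
status: established (equivalence theorems for perfect/mean-field gases [cite: Suto2002, Theorem] [cite: Ueltschi2006, Thm. 1]; the interacting case is open [cite: Ueltschi2006, §5], with an unrefereed claim [claim: Suto2021, status: under-review] and a heuristic counter-scenario [cite: Ueltschi2006PRL, Abstract], neither a published dissent)
[cite: Suto2002, Theorem] [cite: Ueltschi2006, Thm. 1, §5 and App. B Thm. 4] -/
def FeynmanCyclesVersusCondensation : Prop :=
  Suto2002_cyclePercolation ∧ Ueltschi2006_zeroModeOccupation

/-- Unfolding of the catalogue entry. [cite: Suto2002, Theorem] -/
theorem feynmanCyclesVersusCondensation_iff :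
    FeynmanCyclesVersusCondensation ↔
      Suto2002_cyclePercolation ∧ Ueltschi2006_zeroModeOccupation :=
  Iff.rfl

/-- Under the entry, for the perfect gas the cycle-percolation probability and the condensate
fraction coincide (both `(1 - ρ_c/ρ)₊`): Sütő's "BEC iff cycle percolation", perfect-gas case,
as an identity between the two typed limits. [cite: Suto2002, Theorem] -/
theorem FeynmanCyclesVersusCondensation.percolation_iff_bec (h : FeynmanCyclesVersusCondensation)
    {β ρ : ℝ} (hβ : 0 < β) (hρ : 0 < ρ) :
    ∃ P : ℕ → ℝ,
      (∀ j : ℕ, 1 ≤ j →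
        Tendsto (fun N : ℕ => cycleLengthProb β (Literature.MathematicalPhysics.QuantumManyBody.BoseGas.sideLength ρ N) N j) atTop
          (𝓝 (P j))) ∧
      ∃ s : ℝ, HasSum (fun j : ℕ => P (j + 1)) s ∧
        Tendsto (fun N : ℕ => zeroModeOccupation β (Literature.MathematicalPhysics.QuantumManyBody.BoseGas.sideLength ρ N) N /
            Literature.MathematicalPhysics.QuantumManyBody.BoseGas.sideLength ρ N ^ 3 / ρ) atTop (𝓝 (1 - s)) := by
  obtain ⟨P, hP, hsum⟩ := h.1 β ρ hβ hρ
  refine ⟨P, hP, _, hsum, ?_⟩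
  have := (h.2 β ρ hβ hρ).div_const ρ
  rwa [percolationProb_eq_condensateFraction hρ]

end Literature.Barriers.AtomisticToContinuum

/-! ### Ground-state limit of the typed order parameters (barrier audit 2026-08-15)

Fixed volume (`L ≠ 0`) and particle number `N`, `β → ∞`: the order of limits in which the conjunct
`BoseEinsteinCondensation` is posed (ground state at fixed `N, L`, then `N → ∞`). For the perfect gas
on the torus the one-particle ground level is `k = 0` with `tr e^{-jβT_{Λ,1}} → 1`, the distinguishable
`N`-particle ground state is non-degenerate and symmetric, and the canonical permutation law becomes
UNIFORM: `Q_{Λ,N} = ∑_{p ⊢ N} ∏_j (tr e^{-jβT}/j)^{n_j}/n_j! → ∑_{p ⊢ N} ∏_j j^{-n_j}/n_j! = 1` (the class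
equation of `S_N`), `P_{Λ,N}(ξ₁ = j) → 1/N` for every `1 ≤ j ≤ N`, while `⟨n₀⟩_{Λ,N} → N`. -/

namespace Literature.Barriers.AtomisticToContinuum.BoseGas.IdealGas

open Literature.Combinatorics.Enumerative

/-- The one-dimensional theta sum tends to its `n = 0` term: `∑_{n∈ℤ} e^{-t(2πn/L)²} → 1` as
`t → ∞` (`L ≠ 0`; dominated convergence with the `t = 1` terms as majorant). [folklore] -/
theorem tendsto_torusHeatSum_atTop {L : ℝ} (hL : L ≠ 0) :
    Tendsto (fun t : ℝ => ∑' n : ℤ, Real.exp (-(t * (2 * Real.pi * n / L) ^ 2))) atTop (𝓝 1) := by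
  set g : ℤ → ℝ := fun n => if n = 0 then 1 else 0 with hg
  have hg1 : ∑' n : ℤ, g n = 1 := by
    simp [hg]
  rw [← hg1]
  refine tendsto_tsum_of_dominated_convergence
    (bound := fun n : ℤ => Real.exp (-(1 * (2 * Real.pi * n / L) ^ 2)))
    (summable_torusHeat hL one_pos) (fun n => ?_) ?_
  · by_cases hn : n = 0
    · subst hn
      simp [hg]
    · have hc : 0 < (2 * Real.pi * n / L) ^ 2 := by
        have hn' : (n : ℝ) ≠ 0 := by exact_mod_cast hn
        have h2 : (2 * Real.pi * n / L) ≠ 0 := by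
          have : (2 * Real.pi) ≠ 0 := by positivity
          exact div_ne_zero (mul_ne_zero this hn') hL
        positivity
      simp only [hg, hn, if_false]
      exact Real.tendsto_exp_neg_atTop_nhds_zero.comp (tendsto_id.atTop_mul_const hc)
  · filter_upwards [eventually_ge_atTop (1 : ℝ)] with t ht n
    rw [Real.norm_eq_abs, abs_of_pos (Real.exp_pos _), Real.exp_le_exp, neg_le_neg_iff, one_mul]
    exact le_mul_of_one_le_left (sq_nonneg _) ht

/-- **`tr e^{tΔ} → 1` on the torus as `t → ∞`** (only the zero mode survives; `L ≠ 0`): the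
one-particle input of the ground-state limit. [folklore] -/
theorem tendsto_torusHeatTrace_atTop {L : ℝ} (hL : L ≠ 0) :
    Tendsto (fun t : ℝ => torusHeatTrace L t) atTop (𝓝 1) := by
  have := (tendsto_torusHeatSum_atTop hL).pow 3
  simpa [torusHeatTrace] using this

/-- `Q_{Λ,N}` is the cycle-index sum of `S_N` at the weights `x_j = tr e^{-jβT_{Λ,1}}`
(`Literature.Combinatorics.Enumerative.cycleIndexSum`; definitional). [cite: Suto2002, §2.1 (7)] -/
theorem canonicalZ_eq_cycleIndexSum (β L : ℝ) (N : ℕ) :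
    canonicalZ β L N = cycleIndexSum (fun j => torusHeatTrace L (j * β)) N := rfl

/-- The class equation of the symmetric group in cycle-index form:
`∑_{p ⊢ N} ∏_j (1/j)^{n_j}/n_j! = 1` (i.e. `∑_{g ∈ S_N} 1 = N!`), from the cycle-index recursion with
unit weights. [folklore] -/
theorem cycleIndexSum_const_one (N : ℕ) : cycleIndexSum (fun _ => (1 : ℝ)) N = 1 := by
  have h := eq_cycleIndexSum_of_rec (fun _ => (1 : ℝ)) (Z := fun _ => (1 : ℝ)) rfl
    (fun N _ => by simp)
  exact (congrFun h N).symm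

/-- **Ground-state limit of the canonical partition function**: for fixed `L ≠ 0` and `N`,
`Q_{Λ,N} → 1` as `β → ∞` — every permutation `g ∈ S_N` contributes `Tr U(g)e^{-βH} → 1`, the
weights `P_{Λ,N}(g) → 1/N!` become uniform. [folklore] -/
theorem tendsto_canonicalZ_atTop {L : ℝ} (hL : L ≠ 0) (N : ℕ) :
    Tendsto (fun β : ℝ => canonicalZ β L N) atTop (𝓝 1) := by
  have key : Tendsto (fun β : ℝ => canonicalZ β L N) atTop
      (𝓝 (cycleIndexSum (fun j => if j = 0 then torusHeatTrace L 0 else 1) N)) := by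
    simp only [canonicalZ_eq_cycleIndexSum, cycleIndexSum]
    refine tendsto_finsetSum _ fun p _ => tendsto_finsetProd _ fun j hj => ?_
    have hj : 0 < j := p.parts_pos (Multiset.mem_toFinset.mp hj)
    have ht : Tendsto (fun β : ℝ => torusHeatTrace L (j * β)) atTop (𝓝 1) :=
      (tendsto_torusHeatTrace_atTop hL).comp
        (tendsto_id.const_mul_atTop (by exact_mod_cast hj : (0 : ℝ) < j))
    rw [if_neg hj.ne']
    exact ((ht.div_const _).pow _).div_const _
  rwa [cycleIndexSum_congr (x' := fun _ => (1 : ℝ)) (fun j hj => if_neg hj.ne'),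
    cycleIndexSum_const_one] at key

/-- **Ground-state limit of the cycle-length law**: for fixed `L ≠ 0`, `N` and `1 ≤ j ≤ N`,
`P_{Λ,N}(ξ₁ = j) → 1/N` as `β → ∞` — the cycle through a given particle is uniformly distributed in
length, the law of a uniform random permutation ("complete cycle percolation" for every `N`: the mass
of lengths `≤ M` is `M/N`). [folklore] -/
theorem tendsto_cycleLengthProb_atTop {L : ℝ} (hL : L ≠ 0) {N j : ℕ} (hj : 1 ≤ j)
    (hjN : j ≤ N) :
    Tendsto (fun β : ℝ => cycleLengthProb β L N j) atTop (𝓝 (1 / (N : ℝ))) := by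
  have hN : (N : ℝ) ≠ 0 := by
    have : 1 ≤ N := hj.trans hjN
    positivity
  have h1 : Tendsto (fun β : ℝ => torusHeatTrace L (j * β)) atTop (𝓝 1) :=
    (tendsto_torusHeatTrace_atTop hL).comp
      (tendsto_id.const_mul_atTop (by exact_mod_cast hj : (0 : ℝ) < j))
  have h := (h1.mul (tendsto_canonicalZ_atTop hL (N - j))).div
    ((tendsto_canonicalZ_atTop hL N).const_mul (N : ℝ)) (by simpa using hN)
  rw [show (1 : ℝ) * 1 / ((N : ℝ) * 1) = 1 / N by ring] at h
  simp only [cycleLengthProb, hj, hjN, and_self, if_true]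
  exact h

/-- **Ground-state limit of the zero-mode occupation**: for fixed `L ≠ 0` and `N`,
`⟨n₀⟩_{Λ,N} = ∑_{i=1}^{N} Q_{Λ,N-i}/Q_{Λ,N} → N` as `β → ∞` (the perfect-gas ground state is fully
condensed). [folklore] -/
theorem tendsto_zeroModeOccupation_atTop {L : ℝ} (hL : L ≠ 0) (N : ℕ) :
    Tendsto (fun β : ℝ => zeroModeOccupation β L N) atTop (𝓝 (N : ℝ)) := by
  have h : Tendsto (fun β : ℝ => zeroModeOccupation β L N) atTop
      (𝓝 (∑ i ∈ Finset.Icc 1 N, (1 : ℝ) / 1)) := by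
    unfold zeroModeOccupation
    refine tendsto_finsetSum _ fun i _ => ?_
    exact (tendsto_canonicalZ_atTop hL (N - i)).div (tendsto_canonicalZ_atTop hL N) one_ne_zero
  simpa using h

end Literature.Barriers.AtomisticToContinuum.BoseGas.IdealGas

namespace Literature.Barriers.AtomisticToContinuum

open BoseGas.IdealGas

/-- **NARROWED BARRIER `FeynmanCyclesVersusCondensationNarrow` (barrier audit of
`FeynmanCyclesVersusCondensation`, 2026-08-15).** To be read with the catalogued entry above, whose
formal content (the perfect-gas equivalence in cubes at `T > 0`) is discharged in
`Literature.Barriers.AtomisticToContinuum.FeynmanCyclesVersusCondensationProofs`. FORMAL content of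
this entry (three conjuncts, all proved: `feynmanCyclesVersusCondensationNarrow_holds`): for the
perfect gas on the torus of side `L ≠ 0` with `N` FIXED and `β → ∞` — the ground-state order of
limits of `Literature.MathematicalPhysics.QuantumManyBody.BoseGas.HasGroundStateBEC` — (1) `Q_{Λ,N} → 1`
(`= ∑_{g ∈ S_N} 1/N!`: all permutations weigh equally in the limit); (2) `P_{Λ,N}(ξ₁ = j) → 1/N` for
every `1 ≤ j ≤ N` (uniform cycle-length law: for every `M`, the mass of cycle lengths `≤ M` tends to
`M/N`, "complete cycle percolation" at every `N`); (3) `⟨n₀⟩_{Λ,N} → N`.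
BARRIER (D-0021), AtomisticToContinuum/BoseEinsteinCondensation — narrowed:
technique_class: feynman-cycles cycle-percolation infinite-cycles long-cycles macroscopic-cycles permutation-cycles cycle-length-distribution random-permutations spatial-random-permutations winding-numbers — i.e. CLOSED-cycle statistics of the particle permutation in the Feynman–Kac (position-space, Brownian-bridge) representation of `Tr_{sym} e^{-βH_N}`, or in spatial-random-permutation models, used as order parameters. NOT covered although listed in the catalogued entry: (a) `feynman-kac` / `path-integral` / `brownian-bridges` / `loop-gas` estimates of the OPEN cycle ("worm"): the off-diagonal correlation is identically an open-cycle weight, `σ_ρ(x) = ∑_{n=1}^{N} ∫dW^{nβ}_{0x}(ω) e^{-βU(ω)} Y(N-n;ω)/Y(N)`, "an open cycle from `x` to `y`, winding `n` times around the time direction" [cite: Ueltschi2006, §2.3 (odlro) and App. A], so a lower bound on it uniform in `V` and `x` IS off-diagonal long-range order and consumes no cycle-to-condensate implication; (b) `random-loop-representation` for quantum lattice models of the Tóth / Aizenman–Nachtergaele family, where two-point functions ARE loop-connectivity probabilities: `⟨S_x¹;S_y¹⟩(t) = ⟨S_x³;S_y³⟩(t) = ⅓S(S+1)·ℙ(E_{x,y,t})`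 for every `u ∈ [0,1]` [cite: Ueltschi2013, Thm. 3.3]; at `u = ½`, `S = ½` (the spin-½ XY model, "equivalent to the hard-core Bose gas") the condensation correlation is `⟨a_x† a_y⟩ = 2⟨S_x³ S_y³⟩` [cite: Ueltschi2013, §7.1], i.e. `½ℙ(x ↔ y)`: for hard-core lattice bosons "macroscopic loops ⇔ ODLRO" is an identity, and ODLRO itself is a theorem at half filling, `d ≥ 3` [cite: KennedyLiebShastry1988, via Ueltschi2013 §7.1].
blocks: inferring the conjunct's criterion `λ_max(γ_{Ψ₀}) ≥ cN` (`HasGroundStateBEC`, Dirichlet cubes `L = (N/ρ)^{1/3}`) from closed-cycle statistics — more sharply than catalogued: (1) in the conjunct's order of limits (ground state at fixed `N, L`, then `N → ∞`) the statistics are SATURATED: conjuncts (1)–(2) give the uniform permutation law for the perfect gas at every `N`, whatever `N ↦ L_N`; the same limit `P_{Λ,N}(g) → 1/N!` holds for every `H_N` whose distinguishable-particle ground state is non-degenerate (then `U(g)Ψ₀ = ±Ψ₀`, and `= Ψ₀` when `e^{-βH_N}` is positivity improving, so `Tr U(g)P₀ = 1`) [folklore]; in print: "there are only infinite cycles at zero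 temperature … infinite cycles can carry other than the condensate" [cite: Suto2024, concluding remarks p. 11] — at `T = 0` cycle statistics cannot tell condensed from uncondensed ground states; (2) at `T > 0` "cycle percolation ⇒ a macroscopically occupied one-particle level" is FALSE already for the perfect gas outside cubes: in Casimir prisms `L₁ = V^{α₁}`, `α₁ > 1/2`, the density in long cycles is `ρ_long = ρ - ρ_c(β) > 0` for `ρ > ρ_c`, exactly as in the cube [cite: Beau2009, Thm. 2.2], while the condensation is of type III — no single-particle state macroscopically occupied, grand-canonically and canonically [cite: PuleZagrebnov2004, Prop. 2.2 and Cor. 3.2] (entry `CasimirBoxGeneralizedCondensation`), the long cycles being "long-microscopic cycles of the order `V^δ`", `δ = 2(1-α₁) < 1` [cite: Beau2009, Thm. 4.3]; percolation tracks GENERALIZED condensation and ODLRO-after-the-limit ("ODLRO is not equivalent to the usual criterion of BEC (macroscopic occupation of the ground state) but to the generalized BEC") [cite: Beau2009, Thm. 2.1 and §1], and only cycles of length `∝ N` go with macroscopic occupation [cite: Beau2009, §1 and §4]; (3) for interacting gases in cubes the implication is open in both versions [cite: Ueltschi2006, §5]: "the existence of infinite cycles is necessary but not sufficient for BEC" [cite: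 Suto2024, Abstract]; the claimed equivalence for positive-type potentials has the same two thresholds — ODLRO iff infinite cycles, zero-mode condensation iff cycles of length `≥ cN^{2/d}` [claim: Suto2021, status: under-review].
because: the catalogued mechanism stands (`σ(x) = ∑_n c_n(x)ϱ(n) + c_∞(x)ϱ(∞)` with `c_∞` conjectural [cite: Ueltschi2006, §1 and §2.3]); in addition the closed-cycle law is a functional of the diagonal traces `Tr U(g)e^{-βH_N}`, which at fixed `N` lose their `g`-dependence as `β → ∞` (conjuncts (1)–(2); [folklore] beyond the perfect gas), and which for the perfect gas see the one-particle spectrum only through `tr e^{-jβT_{Λ,1}}`, `j ≤ M` — blind to how the surplus `ρ - ρ_c` is spread over the low modes [cite: Beau2009, Thm. 2.2 (proof)]; where both densities are computable they need not agree even when simultaneous: "BEC and the occurrence of infinite cycles is still simultaneous but the associated densities are not the same" in the infinite-range-hopping Bose–Hubbard model [cite: BolandPule2008, via Suto2024 §1] [cite: Boland2009, via Suto2024 §1], whereas they coincide for the perfect, mean-field and perturbed mean-field gases [cite: Suto2002, Theorem] [cite: DorlasMartinPule2005, via Suto2024 §1].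
evasions_known: (i) the open-cycle route (a): not carried out for continuum bosons; on `ℤ^d`, `d ≥ 3`, reflection positivity in a random-loop representation yields macroscopic loops and uniformly positive loop connectivity (a two-point function written as a ratio of partition functions with open paths [cite: QuitmannTaggi2023, Def. 5.1]) for a single-step modification of the Feynman–Kac interacting Bose gas [cite: QuitmannTaggi2023, Thm. 1.1 and §9.1] — its authors identify this with BEC [cite: QuitmannTaggi2023, §9.1.1], which for the Bose dictionary is precisely the step this entry says is unproved (loop connectivity, not `⟨a_x†a_y⟩`); (ii) the exact identities (b) for hard-core lattice bosons / spin-½ models [cite: Ueltschi2013, Thm. 3.3 and §7.1]; (iii) the necessity half for interacting gases with stable integrable pair potentials: all density in finite cycles implies no condensation, via `ρ₀^{N,L} ≤ ∑_n ρ_n^{N,L} L^{-d}∫_Λ e^{-πx²/nλ_β²}dx` [cite: Suto2024, §2 pp. 3–4]; (iv) perfect and mean-field gases as catalogued [cite: Suto2002, Theorem] [cite: Ueltschi2006, Thm. 1 and App. B Thm. 4].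
scope_caveats: (a) conjuncts (1)–(3) are fixed-volume `β → ∞` limits for the PERFECT gas on the torus (the objects `torusHeatTrace`, `canonicalZ`, `cycleLengthProb`, `zeroModeOccupation` of this file); the interacting-gas version of (1)–(2) is the bracketed one-line argument, not typed (no many-body operators in the library); with the thermodynamic limit taken first, `lim_{β→∞} ϱ(∞) = ρ` is a heuristic [cite: Ueltschi2006PRL, section "Feynman cycles in crystals"] resp. a "more probable" scenario [cite: Suto2024, concluding remarks p. 11], and the ground-state cycle percolation of Sütő's "I" [cite: Suto1993, via Suto2002 §1 and §2.3] was not re-read (acquisition filed); (b) the Casimir-prism statement on cycles is grand-canonical with periodic boundary conditions [cite: Beau2009, §2.2 and Thm. 2.2], the type III statement also canonical [cite: PuleZagrebnov2004, Cor. 3.2]; cubes — the conjunct's geometry — are type I, where percolation, macroscopic cycles and zero-mode condensation coincide for the perfect gas [cite: Suto2002, Theorem]; (c) one-dimensional hard cores are no counterexample either way: Brownian bridges on a segment cannot exchange, only the identity permutation contributes [folklore]; (d) [cite: BolandPule2008, via Suto2024 §1] [cite: Boland2009, via Suto2024 §1] [cite: DorlasMartinPule2005, via Suto2024 §1] [cite: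 KennedyLiebShastry1988, via Ueltschi2013 §7.1] were not read; (e) no journal version of [claim: Suto2021, status: under-review] was found (Crossref, 2026-08-15).
status: established (conjuncts proved in this file; the re-scoping statements are page-cited literature)
[cite: Ueltschi2006, §2.3 and §5] [cite: Ueltschi2013, Thm. 3.3 and §7.1] [cite: Beau2009, Thm. 2.2 and Thm. 4.3] [cite: Suto2024, Abstract and p. 11] -/
def FeynmanCyclesVersusCondensationNarrow : Prop :=
  (∀ L : ℝ, L ≠ 0 → ∀ N : ℕ, Tendsto (fun β : ℝ => canonicalZ β L N) atTop (𝓝 1)) ∧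
  (∀ L : ℝ, L ≠ 0 → ∀ N j : ℕ, 1 ≤ j → j ≤ N →
      Tendsto (fun β : ℝ => cycleLengthProb β L N j) atTop (𝓝 (1 / (N : ℝ)))) ∧
  (∀ L : ℝ, L ≠ 0 → ∀ N : ℕ, Tendsto (fun β : ℝ => zeroModeOccupation β L N) atTop (𝓝 (N : ℝ)))

/-- **Proof of the narrowed barrier**: the three conjuncts are `tendsto_canonicalZ_atTop`,
`tendsto_cycleLengthProb_atTop` and `tendsto_zeroModeOccupation_atTop`. [folklore] -/
theorem feynmanCyclesVersusCondensationNarrow_holds : FeynmanCyclesVersusCondensationNarrow :=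
  ⟨fun _ hL N => tendsto_canonicalZ_atTop hL N,
    fun _ hL _ _ hj hjN => tendsto_cycleLengthProb_atTop hL hj hjN,
    fun _ hL N => tendsto_zeroModeOccupation_atTop hL N⟩

/-- **Saturation in Sütő's variable**: under the narrowed entry, for fixed `L ≠ 0`, `N ≥ 1` and any
cut-off `M ≤ N`, the probability that particle `1` lies in a cycle of length `≤ M` tends to `M/N` as
`β → ∞` — so for every `M` it is `≤ M/N → 0` along `N → ∞`: in the ground-state order of limits the
perfect gas "percolates completely" regardless of the density sequence `N ↦ L_N`.
[cite: Suto2002, §1 (4)–(5)] -/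
theorem FeynmanCyclesVersusCondensationNarrow.tendsto_sum_cycleLengthProb
    (h : FeynmanCyclesVersusCondensationNarrow) {L : ℝ} (hL : L ≠ 0) {N M : ℕ} (hMN : M ≤ N) :
    Tendsto (fun β : ℝ => ∑ j ∈ Finset.Icc 1 M, cycleLengthProb β L N j) atTop
      (𝓝 ((M : ℝ) / N)) := by
  have hs : Tendsto (fun β : ℝ => ∑ j ∈ Finset.Icc 1 M, cycleLengthProb β L N j) atTop
      (𝓝 (∑ j ∈ Finset.Icc 1 M, (1 : ℝ) / N)) :=
    tendsto_finsetSum _ fun j hj =>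
      h.2.1 L hL N j (Finset.mem_Icc.mp hj).1 ((Finset.mem_Icc.mp hj).2.trans hMN)
  simpa [div_eq_mul_inv] using hs

end Literature.Barriers.AtomisticToContinuum

end
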